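import Literature.Probability.RandomMatrixProducts.AndersonModel1DLargeDeviations
import Mathlib.Analysis.SpecialFunctions.Pow.Continuity
import Mathlib.MeasureTheory.Integral.Lebesgue.Markov
import Mathlib.Analysis.Complex.ExponentialBounds
import HarnessLib

/-!
# Large deviations for the Anderson model, I: from one-scale uniform moment bounds to the exponential, uniform-in-energy large-deviation estimate

Companion to `AndersonModel1D.lean` (Bucaj–Damanik–Fillman–Gerbuz–VandenBoom–Wang–Zhang, *Localization for
the one-dimensional Anderson model via positivity and large deviations for the Lyapunov exponent*, TAMS
**372** (2019), arXiv:1706.06135, §3).  Everything here is PROVED.  This file is the first of the files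
discharging the named fact `BucajEtAl2019_vectorLDT` (Prop. 3.6 of the paper).

## Content

* The standing constants of §3: on the energy window `Σ̂ = [-κ, κ]` (`κ = andersonKappa μ`) and for
  potentials in the support `𝒜 = supp μ` one has `|E - α| ≤ 2κ - 2`, so `Γ := 2κ - 1`
  (a local notation `Γ[μ]`) bounds `‖M^E(α)‖` and `‖M^E(α)⁻¹‖`; almost surely `Γ^{-n} ≤ ‖M_n v‖ ≤ Γ^n` for unit
  `v`, and `0 ≤ L(E) ≤ log Γ`.
* **The bootstrapping step** (`vectorLDT_of_uniformScale`): if at ONE scale `N` the log-moments are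
  uniformly close to `N L(E)`,
  `|∫ log ‖M_N^E v‖ dμ^{⊗N} - N L(E)| ≤ N ε` for all `E ∈ Σ̂` and all unit `v`, for every `ε > 0`, then
  the vectorwise large-deviation estimate of Prop. 3.6 holds with constants `C, η` uniform in
  `E ∈ Σ̂`, in the unit vector and in `n ≥ 1`.  The proof is the moment (Chernoff) version of the block
  argument of the paper: the one-scale bound gives `∫ ‖M_N v‖^{∓t} ≤ e^{∓tN(L ∓ ε/2)}` for a suitable
  `t = t(ε, N, Γ) > 0` (`integral_exp_neg_mul_le` of `AndersonModel1DEstimates`), the cocycle identity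
  `M_{n+N}(x ⧺ y) v = M_N(y) (M_n(x) v)` and Tonelli over the two blocks (`lintegral_pi_fin_add`)
  propagate it to all `n` (`lintegral_rpow_norm_apply_le`), and Markov's inequality finishes.

The remaining (and main) input — the one-scale uniform bounds, i.e. `n⁻¹ 𝔼 log ‖M_n^E v‖ → L(E)`
uniformly in `(E, v)` — is proved in the sequel files from the non-atomicity of stationary measures.

Design: all finite-volume probabilities are written, as in `AndersonModel1D.lean`, on the `n`-fold
product `μ^{⊗n}` of the single-site law over `Fin n → ℝ`; moments are `lintegral`s of
`ENNReal.ofReal (‖M_n v‖ ^ τ)` with a real exponent `τ`, so that one propagation lemma serves both tails.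
-/

noncomputable section

open MeasureTheory Set Filter
open scoped Matrix.Norms.L2Operator ENNReal

namespace Literature.Probability.RandomMatrixProducts

/-! ### The standing constants on the energy window `Σ̂ = [-κ, κ]` -/

/-- `Γ := 2κ - 1`: a common bound for `‖M^E(α)‖` and `‖M^E(α)⁻¹‖` over `E ∈ Σ̂ = [-κ, κ]`, `α ∈ 𝒜`
(`|E - α| + 1 ≤ κ + (κ - 2) + 1`); the constant `Γ` of [BucajEtAl2019, §3, display (3.3)] (up to the
harmless replacement of `max_𝒜 |E - α| + 1` by `2κ - 1`). A local notation, not a definition. -/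
local notation "Γ[" μ "]" => (2 * andersonKappa μ - 1 : ℝ)

/-- The auxiliary constant `B = (8 log Γ + 4)/ε` bounding the normalised one-block log-moment (local
notation). -/
local notation "ldtB[" μ "," ε "]" => ((8 * Real.log Γ[μ] + 4) / ε : ℝ)

/-- The Chernoff exponent `t = 4 s/(N ε)`, `s = 1/(2B²)` (local notation). -/
local notation "ldtT[" μ "," ε "," N "]" => (4 * (1 / (2 * ldtB[μ,ε] ^ 2)) / ((N : ℝ) * ε) : ℝ)

/-- `Γ ≥ 3`. [folklore] -/
theorem three_le_gam (μ : Measure ℝ) : 3 ≤ Γ[μ] := by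
  have := two_le_andersonKappa μ
  linarith

/-- `Γ ≥ 1`. [folklore] -/
theorem one_le_gam (μ : Measure ℝ) : 1 ≤ Γ[μ] := by
  linarith [three_le_gam μ]

/-- `Γ > 0`. [folklore] -/
theorem gam_pos (μ : Measure ℝ) : 0 < Γ[μ] := by
  linarith [three_le_gam μ]

/-- `log Γ ≥ 1` (`Γ ≥ 3 > e`). [folklore] -/
theorem one_le_log_gam (μ : Measure ℝ) : 1 ≤ Real.log (Γ[μ]) := by
  rw [Real.le_log_iff_exp_le (gam_pos μ)]
  linarith [three_le_gam μ, Real.exp_one_lt_three]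

/-- `log Γ > 0`. [folklore] -/
theorem log_gam_pos (μ : Measure ℝ) : 0 < Real.log (Γ[μ]) := by
  linarith [one_le_log_gam μ]

/-- On `Σ̂ × 𝒜`: `|E - α| ≤ 2κ - 2 = Γ - 1`. [cite: BucajEtAl2019, §3 (display (3.3))] -/
theorem abs_sub_le_gam_sub_one {μ : Measure ℝ} {E a : ℝ}
    (hE : E ∈ Icc (-andersonKappa μ) (andersonKappa μ)) (ha : |a| ≤ andersonKappa μ - 2) :
    |E - a| ≤ Γ[μ] - 1 := by
  have h1 : |E| ≤ andersonKappa μ := abs_le.mpr ⟨hE.1, hE.2⟩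
  calc |E - a| ≤ |E| + |a| := abs_sub _ _
    _ ≤ andersonKappa μ + (andersonKappa μ - 2) := add_le_add h1 ha
    _ = Γ[μ] - 1 := by ring

/-- On the support box the potentials of a finite sample satisfy `|E - α_k| ≤ Γ - 1`. [folklore] -/
theorem abs_sub_padSeq_le_gam_sub_one {μ : Measure ℝ} {E : ℝ}
    (hE : E ∈ Icc (-andersonKappa μ) (andersonKappa μ)) {n : ℕ} {x : Fin n → ℝ}
    (hx : ∀ i, |x i| ≤ andersonKappa μ - 2) : ∀ k, k < n → |E - padSeq x k| ≤ Γ[μ] - 1 := by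
  intro k hk
  rw [padSeq_of_lt x hk]
  exact abs_sub_le_gam_sub_one hE (hx ⟨k, hk⟩)

/-- Almost every finite sample lies in the support box. [folklore] -/
theorem ae_pi_abs_le_kappa_sub_two {μ : Measure ℝ} [IsProbabilityMeasure μ] (hc : IsCompact μ.support)
    (n : ℕ) : ∀ᵐ x ∂(Measure.pi fun _ : Fin n => μ), ∀ i, |x i| ≤ andersonKappa μ - 2 :=
  ae_pi_abs_le (ae_abs_le_andersonKappa_sub_two μ hc) n

/-- **Growth and co-growth on the support box**: `Γ^{-n} ‖v‖ ≤ ‖M_n v‖ ≤ Γ^n ‖v‖`.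
[cite: BucajEtAl2019, §3 (display (3.3))] -/
theorem norm_apply_bounds_of_box {μ : Measure ℝ} {E : ℝ} (hE : E ∈ Icc (-andersonKappa μ) (andersonKappa μ))
    {n : ℕ} {x : Fin n → ℝ} (hx : ∀ i, |x i| ≤ andersonKappa μ - 2) (v : EuclideanSpace ℝ (Fin 2))
    (k : ℕ) (hk : k ≤ n) :
    ‖Matrix.toEuclideanLin (andersonTransferProd E (padSeq x) k) v‖ ≤ Γ[μ] ^ k * ‖v‖ ∧
    ‖v‖ ≤ Γ[μ] ^ k * ‖Matrix.toEuclideanLin (andersonTransferProd E (padSeq x) k) v‖ := by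
  have hD : 0 ≤ Γ[μ] - 1 := by linarith [one_le_gam μ]
  have h := norm_andersonTransferProd_apply_bounds E hD (padSeq x) v k
    (fun j hj => abs_sub_padSeq_le_gam_sub_one hE hx j (lt_of_lt_of_le hj hk))
  simpa using h

/-- **Operator-norm growth on the support box**: `‖M_k‖ ≤ Γ^k`. [cite: BucajEtAl2019, §3 (display (3.3))] -/
theorem norm_le_of_box {μ : Measure ℝ} {E : ℝ} (hE : E ∈ Icc (-andersonKappa μ) (andersonKappa μ))
    {n : ℕ} {x : Fin n → ℝ} (hx : ∀ i, |x i| ≤ andersonKappa μ - 2) (k : ℕ) (hk : k ≤ n) :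
    ‖andersonTransferProd E (padSeq x) k‖ ≤ Γ[μ] ^ k := by
  have hD : 0 ≤ Γ[μ] - 1 := by linarith [one_le_gam μ]
  have h := norm_andersonTransferProd_le E hD (padSeq x) k
    (fun j hj => abs_sub_padSeq_le_gam_sub_one hE hx j (lt_of_lt_of_le hj hk))
  simpa using h

/-- For ANY finite sample (not only in the box) the transfer products do not annihilate non-zero
vectors: `‖M_k v‖ > 0` for `v ≠ 0`. [folklore] -/
theorem norm_apply_pos (E : ℝ) {n : ℕ} (x : Fin n → ℝ) {v : EuclideanSpace ℝ (Fin 2)} (hv : v ≠ 0)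
    (k : ℕ) : 0 < ‖Matrix.toEuclideanLin (andersonTransferProd E (padSeq x) k) v‖ := by
  -- co-growth with the sample's own bound `D = |E| + Σ |x_i|`
  set D : ℝ := |E| + ∑ i, |x i| with hD
  have hS0 : 0 ≤ ∑ i, |x i| := Finset.sum_nonneg fun i _ => abs_nonneg _
  have hD0 : 0 ≤ D := add_nonneg (abs_nonneg _) hS0
  have hb : ∀ j, j < k → |E - padSeq x j| ≤ D := by
    intro j _
    by_cases hj : j < n
    · rw [padSeq_of_lt x hj]
      have h1 : |x ⟨j, hj⟩| ≤ ∑ i, |x i| :=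
        Finset.single_le_sum (f := fun i => |x i|) (fun i _ => abs_nonneg _) (Finset.mem_univ _)
      calc |E - x ⟨j, hj⟩| ≤ |E| + |x ⟨j, hj⟩| := abs_sub _ _
        _ ≤ D := by rw [hD]; gcongr
    · rw [padSeq_of_le x (not_lt.mp hj), sub_zero, hD]
      linarith
  have h := (norm_andersonTransferProd_apply_bounds E hD0 (padSeq x) v k hb).2
  have hvpos : 0 < ‖v‖ := norm_pos_iff.mpr hv
  by_contra hle
  rw [not_lt] at hle
  have h0 : ‖Matrix.toEuclideanLin (andersonTransferProd E (padSeq x) k) v‖ = 0 :=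
    le_antisymm hle (norm_nonneg _)
  rw [h0, mul_zero] at h
  linarith

/-- A unit vector is non-zero. [folklore] -/
theorem ne_zero_of_norm_eq_one {v : EuclideanSpace ℝ (Fin 2)} (hv : ‖v‖ = 1) : v ≠ 0 := by
  intro h; rw [h, norm_zero] at hv; exact zero_ne_one hv

/-- The normalised image `M_k v / ‖M_k v‖` of a non-zero vector is a unit vector. [folklore] -/
theorem norm_normalize_apply (E : ℝ) {n : ℕ} (x : Fin n → ℝ) {v : EuclideanSpace ℝ (Fin 2)} (hv : v ≠ 0)
    (k : ℕ) :
    ‖(‖Matrix.toEuclideanLin (andersonTransferProd E (padSeq x) k) v‖)⁻¹ •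
        Matrix.toEuclideanLin (andersonTransferProd E (padSeq x) k) v‖ = 1 := by
  rw [norm_smul, norm_inv, norm_norm]
  exact inv_mul_cancel₀ (norm_apply_pos E x hv k).ne'

/-! ### Bounds for the Lyapunov exponent: `0 ≤ L ≤ log Γ` -/

/-- `α ↦ log ‖M_k(α)‖` is measurable. [folklore] -/
theorem measurable_log_norm_andersonTransferProd (E : ℝ) {n : ℕ} (k : ℕ) :
    Measurable fun α : Fin n → ℝ => Real.log ‖andersonTransferProd E (padSeq α) k‖ :=
  (continuous_andersonTransferProd E k).norm.measurable.log

/-- `α ↦ log ‖M_k(α) v‖` is measurable. [folklore] -/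
theorem measurable_log_norm_andersonTransferProd_apply (E : ℝ) {n : ℕ} (k : ℕ) (v : EuclideanSpace ℝ (Fin 2)) :
    Measurable fun α : Fin n → ℝ => Real.log ‖Matrix.toEuclideanLin (andersonTransferProd E (padSeq α) k) v‖ :=
  (measurable_norm_andersonTransferProd_apply E k v).log

/-- On the support box, `log ‖M_k‖ ≤ k log Γ` (`k ≤ n`). [cite: BucajEtAl2019, §3 (display (3.3))] -/
theorem log_norm_le_of_box {μ : Measure ℝ} {E : ℝ} (hE : E ∈ Icc (-andersonKappa μ) (andersonKappa μ))
    {n : ℕ} {x : Fin n → ℝ} (hx : ∀ i, |x i| ≤ andersonKappa μ - 2) (k : ℕ) (hk : k ≤ n) :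
    Real.log ‖andersonTransferProd E (padSeq x) k‖ ≤ k * Real.log (Γ[μ]) := by
  rw [← Real.log_pow]
  exact Real.log_le_log (lt_of_lt_of_le zero_lt_one (one_le_norm_of_det_eq_one _ (det_andersonTransferProd _ _ _)))
    (norm_le_of_box hE hx k hk)

/-- On the support box, `|log ‖M_k v‖| ≤ k log Γ` for a unit vector `v` (`k ≤ n`). [cite: BucajEtAl2019, §3 (display (3.3))] -/
theorem abs_log_norm_apply_le_of_box {μ : Measure ℝ} {E : ℝ} (hE : E ∈ Icc (-andersonKappa μ) (andersonKappa μ))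
    {n : ℕ} {x : Fin n → ℝ} (hx : ∀ i, |x i| ≤ andersonKappa μ - 2) {v : EuclideanSpace ℝ (Fin 2)}
    (hv : ‖v‖ = 1) (k : ℕ) (hk : k ≤ n) :
    |Real.log ‖Matrix.toEuclideanLin (andersonTransferProd E (padSeq x) k) v‖| ≤
      k * Real.log (Γ[μ]) := by
  obtain ⟨h1, h2⟩ := norm_apply_bounds_of_box hE hx v k hk
  rw [hv, mul_one] at h1
  rw [hv] at h2
  have hΓ := gam_pos μ
  have hpow : 0 < Γ[μ] ^ k := pow_pos hΓ k
  have hpos := norm_apply_pos E x (ne_zero_of_norm_eq_one hv) k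
  rw [abs_le, ← Real.log_pow]
  constructor
  · rw [← Real.log_inv]
    refine Real.log_le_log (inv_pos.mpr hpow) ?_
    rw [inv_le_iff_one_le_mul₀ hpow, mul_comm]
    exact h2
  · exact Real.log_le_log hpos h1

/-- `log ‖M_k‖` is integrable over the `n`-site law (`k ≤ n`). [folklore] -/
theorem integrable_log_norm {μ : Measure ℝ} [IsProbabilityMeasure μ] (hc : IsCompact μ.support) {E : ℝ}
    (hE : E ∈ Icc (-andersonKappa μ) (andersonKappa μ)) {n : ℕ} (k : ℕ) (hk : k ≤ n) :
    Integrable (fun α : Fin n → ℝ => Real.log ‖andersonTransferProd E (padSeq α) k‖)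
      (Measure.pi fun _ : Fin n => μ) := by
  refine Integrable.of_bound (measurable_log_norm_andersonTransferProd E k).aestronglyMeasurable
    (k * Real.log (Γ[μ])) ?_
  filter_upwards [ae_pi_abs_le_kappa_sub_two hc n] with x hx
  rw [Real.norm_eq_abs, abs_of_nonneg (log_norm_andersonTransferProd_nonneg E _ k)]
  exact log_norm_le_of_box hE hx k hk

/-- `log ‖M_k v‖` is integrable over the `n`-site law (`k ≤ n`, `v` a unit vector). [folklore] -/
theorem integrable_log_norm_apply {μ : Measure ℝ} [IsProbabilityMeasure μ] (hc : IsCompact μ.support) {E : ℝ}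
    (hE : E ∈ Icc (-andersonKappa μ) (andersonKappa μ)) {n : ℕ} (k : ℕ) (hk : k ≤ n)
    {v : EuclideanSpace ℝ (Fin 2)} (hv : ‖v‖ = 1) :
    Integrable (fun α : Fin n → ℝ => Real.log ‖Matrix.toEuclideanLin (andersonTransferProd E (padSeq α) k) v‖)
      (Measure.pi fun _ : Fin n => μ) := by
  refine Integrable.of_bound (measurable_log_norm_andersonTransferProd_apply E k v).aestronglyMeasurable
    (k * Real.log (Γ[μ])) ?_
  filter_upwards [ae_pi_abs_le_kappa_sub_two hc n] with x hx
  rw [Real.norm_eq_abs]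
  exact abs_log_norm_apply_le_of_box hE hx hv k hk

/-! ### Moments of `‖M_n v‖` and their propagation along blocks -/

/-- `z ↦ ‖M_k(z) v‖ ^ τ` is measurable (`v ≠ 0`, real exponent). [folklore] -/
theorem measurable_rpow_norm_apply (E τ : ℝ) {n : ℕ} (k : ℕ) {v : EuclideanSpace ℝ (Fin 2)} (hv : v ≠ 0) :
    Measurable fun z : Fin n → ℝ => ‖Matrix.toEuclideanLin (andersonTransferProd E (padSeq z) k) v‖ ^ τ :=
  ((continuous_andersonTransferProd_apply E k v).norm.rpow_const
    (fun z => Or.inl (norm_apply_pos E z hv k).ne')).measurable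

/-- **Block propagation of moments** (the independence step of the proof of Prop. 3.6, in moment form):
if `∫ ‖M_N u‖^τ dμ^{⊗N} ≤ c` for every unit vector `u`, then for every unit `w`
`∫ ‖M_{n+N} w‖^τ dμ^{⊗(n+N)} ≤ c ∫ ‖M_n w‖^τ dμ^{⊗n}`, because `M_{n+N}(x ⧺ y) w = M_N(y)(M_n(x) w)` and
`‖M_N(y)(M_n(x) w)‖^τ = ‖M_n(x) w‖^τ ‖M_N(y) u_x‖^τ` with the unit vector `u_x ∥ M_n(x) w` (Tonelli over the two
blocks). [cite: BucajEtAl2019, §3 (proof of Prop. 3.6, eq. (3.15)–(3.16))] -/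
theorem lintegral_rpow_norm_apply_add (μ : Measure ℝ) [IsProbabilityMeasure μ] (E τ : ℝ) (n N : ℕ) {c : ℝ≥0∞}
    (hN : ∀ u : EuclideanSpace ℝ (Fin 2), ‖u‖ = 1 →
      ∫⁻ y, ENNReal.ofReal (‖Matrix.toEuclideanLin (andersonTransferProd E (padSeq y) N) u‖ ^ τ)
        ∂(Measure.pi fun _ : Fin N => μ) ≤ c)
    {w : EuclideanSpace ℝ (Fin 2)} (hw : ‖w‖ = 1) :
    ∫⁻ z, ENNReal.ofReal (‖Matrix.toEuclideanLin (andersonTransferProd E (padSeq z) (n + N)) w‖ ^ τ)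
        ∂(Measure.pi fun _ : Fin (n + N) => μ) ≤
      c * ∫⁻ x, ENNReal.ofReal (‖Matrix.toEuclideanLin (andersonTransferProd E (padSeq x) n) w‖ ^ τ)
        ∂(Measure.pi fun _ : Fin n => μ) := by
  have hw0 := ne_zero_of_norm_eq_one hw
  rw [lintegral_pi_fin_add μ n N ((measurable_rpow_norm_apply E τ (n + N) hw0).ennreal_ofReal)]
  have key : ∀ x : Fin n → ℝ,
      ∫⁻ y, ENNReal.ofReal (‖Matrix.toEuclideanLin (andersonTransferProd E (padSeq (Fin.append x y)) (n + N)) w‖ ^ τ)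
        ∂(Measure.pi fun _ : Fin N => μ) ≤
      ENNReal.ofReal (‖Matrix.toEuclideanLin (andersonTransferProd E (padSeq x) n) w‖ ^ τ) * c := by
    intro x
    set a : ℝ := ‖Matrix.toEuclideanLin (andersonTransferProd E (padSeq x) n) w‖ with ha_def
    have ha : 0 < a := norm_apply_pos E x hw0 n
    set u : EuclideanSpace ℝ (Fin 2) := a⁻¹ • Matrix.toEuclideanLin (andersonTransferProd E (padSeq x) n) w
      with hu_def
    have hu : ‖u‖ = 1 := norm_normalize_apply E x hw0 n
    have hxy : ∀ y : Fin N → ℝ,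
        ‖Matrix.toEuclideanLin (andersonTransferProd E (padSeq (Fin.append x y)) (n + N)) w‖ =
          a * ‖Matrix.toEuclideanLin (andersonTransferProd E (padSeq y) N) u‖ := by
      intro y
      rw [andersonTransferProd_append, toEuclideanLin_mul_apply]
      have h1 : Matrix.toEuclideanLin (andersonTransferProd E (padSeq x) n) w = a • u := by
        rw [hu_def, smul_smul, mul_inv_cancel₀ ha.ne', one_smul]
      rw [h1, map_smul, norm_smul, Real.norm_eq_abs, abs_of_pos ha]
    have hmeas : Measurable fun y : Fin N → ℝ =>
        ENNReal.ofReal (‖Matrix.toEuclideanLin (andersonTransferProd E (padSeq y) N) u‖ ^ τ) :=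
      (measurable_rpow_norm_apply E τ N (ne_zero_of_norm_eq_one hu)).ennreal_ofReal
    calc ∫⁻ y, ENNReal.ofReal (‖Matrix.toEuclideanLin (andersonTransferProd E (padSeq (Fin.append x y)) (n + N)) w‖ ^ τ)
          ∂(Measure.pi fun _ : Fin N => μ)
        = ∫⁻ y, ENNReal.ofReal (a ^ τ) *
            ENNReal.ofReal (‖Matrix.toEuclideanLin (andersonTransferProd E (padSeq y) N) u‖ ^ τ)
            ∂(Measure.pi fun _ : Fin N => μ) := by
          refine lintegral_congr fun y => ?_
          rw [hxy y, Real.mul_rpow ha.le (norm_nonneg _), ENNReal.ofReal_mul (Real.rpow_nonneg ha.le τ)]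
      _ = ENNReal.ofReal (a ^ τ) * ∫⁻ y,
            ENNReal.ofReal (‖Matrix.toEuclideanLin (andersonTransferProd E (padSeq y) N) u‖ ^ τ)
            ∂(Measure.pi fun _ : Fin N => μ) := lintegral_const_mul _ hmeas
      _ ≤ ENNReal.ofReal (a ^ τ) * c := by gcongr; exact hN u hu
  calc ∫⁻ x, ∫⁻ y, ENNReal.ofReal
          (‖Matrix.toEuclideanLin (andersonTransferProd E (padSeq (Fin.append x y)) (n + N)) w‖ ^ τ)
          ∂(Measure.pi fun _ : Fin N => μ) ∂(Measure.pi fun _ : Fin n => μ)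
      ≤ ∫⁻ x, ENNReal.ofReal (‖Matrix.toEuclideanLin (andersonTransferProd E (padSeq x) n) w‖ ^ τ) * c
          ∂(Measure.pi fun _ : Fin n => μ) := lintegral_mono key
    _ = (∫⁻ x, ENNReal.ofReal (‖Matrix.toEuclideanLin (andersonTransferProd E (padSeq x) n) w‖ ^ τ)
          ∂(Measure.pi fun _ : Fin n => μ)) * c :=
        lintegral_mul_const _ (measurable_rpow_norm_apply E τ n hw0).ennreal_ofReal
    _ = _ := mul_comm _ _

/-- **Iterated block propagation**: a one-scale moment bound `∫ ‖M_N u‖^τ ≤ c` (all unit `u`) and an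
initial bound `∫ ‖M_j u‖^τ ≤ A` for `j < N` give `∫ ‖M_m w‖^τ dμ^{⊗m} ≤ A c^{⌊m/N⌋}` for all `m` and all unit
`w`. [cite: BucajEtAl2019, §3 (proof of Prop. 3.6, eq. (3.17))] -/
theorem lintegral_rpow_norm_apply_le (μ : Measure ℝ) [IsProbabilityMeasure μ] (E τ : ℝ) {N : ℕ} (hN1 : 1 ≤ N)
    {c A : ℝ≥0∞}
    (hN : ∀ u : EuclideanSpace ℝ (Fin 2), ‖u‖ = 1 →
      ∫⁻ y, ENNReal.ofReal (‖Matrix.toEuclideanLin (andersonTransferProd E (padSeq y) N) u‖ ^ τ)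
        ∂(Measure.pi fun _ : Fin N => μ) ≤ c)
    (hA : ∀ j, j < N → ∀ u : EuclideanSpace ℝ (Fin 2), ‖u‖ = 1 →
      ∫⁻ y, ENNReal.ofReal (‖Matrix.toEuclideanLin (andersonTransferProd E (padSeq y) j) u‖ ^ τ)
        ∂(Measure.pi fun _ : Fin j => μ) ≤ A) :
    ∀ (m : ℕ) (w : EuclideanSpace ℝ (Fin 2)), ‖w‖ = 1 →
      ∫⁻ z, ENNReal.ofReal (‖Matrix.toEuclideanLin (andersonTransferProd E (padSeq z) m) w‖ ^ τ)
        ∂(Measure.pi fun _ : Fin m => μ) ≤ A * c ^ (m / N) := by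
  intro m
  induction m using Nat.strong_induction_on with
  | _ m ih =>
    intro w hw
    rcases lt_or_ge m N with hm | hm
    · rw [Nat.div_eq_of_lt hm, pow_zero, mul_one]
      exact hA m hm w hw
    · obtain ⟨n, rfl⟩ : ∃ n, m = n + N := ⟨m - N, by omega⟩
      rw [Nat.add_div_right _ (by omega : 0 < N), pow_succ]
      calc _ ≤ c * ∫⁻ x, ENNReal.ofReal (‖Matrix.toEuclideanLin (andersonTransferProd E (padSeq x) n) w‖ ^ τ)
            ∂(Measure.pi fun _ : Fin n => μ) := lintegral_rpow_norm_apply_add μ E τ n N hN hw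
        _ ≤ c * (A * c ^ (n / N)) := by gcongr; exact ih n (by omega) w hw
        _ = A * (c ^ (n / N) * c) := by ring

/-- The trivial moment bound on the support box: `∫ ‖M_j u‖^τ dμ^{⊗j} ≤ (Γ^j)^{|τ|}`. [folklore] -/
theorem lintegral_rpow_norm_apply_le_pow {μ : Measure ℝ} [IsProbabilityMeasure μ] (hc : IsCompact μ.support)
    {E : ℝ} (hE : E ∈ Icc (-andersonKappa μ) (andersonKappa μ)) (τ : ℝ) (j : ℕ)
    {u : EuclideanSpace ℝ (Fin 2)} (hu : ‖u‖ = 1) :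
    ∫⁻ y, ENNReal.ofReal (‖Matrix.toEuclideanLin (andersonTransferProd E (padSeq y) j) u‖ ^ τ)
        ∂(Measure.pi fun _ : Fin j => μ) ≤ ENNReal.ofReal ((Γ[μ] ^ j) ^ |τ|) := by
  have hΓ := gam_pos μ
  have hG : 0 < Γ[μ] ^ j := pow_pos hΓ j
  have hG1 : 1 ≤ Γ[μ] ^ j := one_le_pow₀ (one_le_gam μ)
  have hpt : ∀ᵐ y ∂(Measure.pi fun _ : Fin j => μ),
      ENNReal.ofReal (‖Matrix.toEuclideanLin (andersonTransferProd E (padSeq y) j) u‖ ^ τ) ≤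
        ENNReal.ofReal ((Γ[μ] ^ j) ^ |τ|) := by
    filter_upwards [ae_pi_abs_le_kappa_sub_two hc j] with y hy
    apply ENNReal.ofReal_le_ofReal
    obtain ⟨h1, h2⟩ := norm_apply_bounds_of_box hE hy u j le_rfl
    rw [hu, mul_one] at h1
    rw [hu] at h2
    set a := ‖Matrix.toEuclideanLin (andersonTransferProd E (padSeq y) j) u‖ with ha_def
    have ha : 0 < a := norm_apply_pos E y (ne_zero_of_norm_eq_one hu) j
    rcases le_or_gt 0 τ with hτ | hτ
    · rw [abs_of_nonneg hτ]
      exact Real.rpow_le_rpow ha.le h1 hτ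
    · rw [abs_of_neg hτ]
      -- a ≥ Γ^{-j}, so a^τ ≤ (Γ^{-j})^τ = (Γ^j)^{-τ}
      have hinv : (Γ[μ] ^ j)⁻¹ ≤ a := by
        rw [inv_le_iff_one_le_mul₀ hG, mul_comm]; exact h2
      calc a ^ τ ≤ ((Γ[μ] ^ j)⁻¹) ^ τ := Real.rpow_le_rpow_of_nonpos (inv_pos.mpr hG) hinv hτ.le
        _ = (Γ[μ] ^ j) ^ (-τ) := by
            rw [Real.inv_rpow hG.le, Real.rpow_neg hG.le]
  calc ∫⁻ y, ENNReal.ofReal (‖Matrix.toEuclideanLin (andersonTransferProd E (padSeq y) j) u‖ ^ τ)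
        ∂(Measure.pi fun _ : Fin j => μ)
      ≤ ∫⁻ _y, ENNReal.ofReal ((Γ[μ] ^ j) ^ |τ|) ∂(Measure.pi fun _ : Fin j => μ) :=
        lintegral_mono_ae hpt
    _ = ENNReal.ofReal ((Γ[μ] ^ j) ^ |τ|) := by rw [lintegral_const, measure_univ, mul_one]

/-! ### The one-scale moment bounds from the one-scale log-moment bounds -/

/-- `B ≥ 1` for `0 < ε ≤ 1`. [folklore] -/
theorem one_le_ldtB (μ : Measure ℝ) {ε : ℝ} (hε0 : 0 < ε) (hε1 : ε ≤ 1) : 1 ≤ ldtB[μ,ε] := by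
  rw [le_div_iff₀ hε0]
  linarith [one_le_log_gam μ]

/-- `B > 0`. [folklore] -/
theorem ldtB_pos (μ : Measure ℝ) {ε : ℝ} (hε0 : 0 < ε) : 0 < ldtB[μ,ε] := by
  have := log_gam_pos μ
  positivity

/-- `t > 0`. [folklore] -/
theorem ldtT_pos (μ : Measure ℝ) {ε : ℝ} (hε0 : 0 < ε) {N : ℕ} (hN1 : 1 ≤ N) : 0 < ldtT[μ,ε,N] := by
  have := ldtB_pos μ hε0
  have hN : (0 : ℝ) < N := by exact_mod_cast hN1
  positivity

/-- **Lower one-scale moment bound.** If `∫ log ‖M_N u‖ dμ^{⊗N} ≥ N (L - ε/4)` for all unit `u`, then with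
`t = ldtT[μ,ε,N]`, `∫ ‖M_N u‖^{-t} dμ^{⊗N} ≤ e^{-tN(L - ε/2)}` for all unit `u`.
[cite: BucajEtAl2019, §3 (Prop. 3.4 ⇒ Prop. 3.6, lower deviations; moment form)] -/
theorem lintegral_rpow_neg_le {μ : Measure ℝ} [IsProbabilityMeasure μ] (hc : IsCompact μ.support)
    {E : ℝ} (hE : E ∈ Icc (-andersonKappa μ) (andersonKappa μ)) {ε : ℝ} (hε0 : 0 < ε) (hε1 : ε ≤ 1)
    {N : ℕ} (hN1 : 1 ≤ N)
    (hlow : ∀ u : EuclideanSpace ℝ (Fin 2), ‖u‖ = 1 →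
      (N : ℝ) * (andersonLyapunov μ E - ε / 4) ≤
        ∫ y, Real.log ‖Matrix.toEuclideanLin (andersonTransferProd E (padSeq y) N) u‖ ∂(Measure.pi fun _ : Fin N => μ))
    {u : EuclideanSpace ℝ (Fin 2)} (hu : ‖u‖ = 1) :
    ∫⁻ y, ENNReal.ofReal (‖Matrix.toEuclideanLin (andersonTransferProd E (padSeq y) N) u‖ ^ (-ldtT[μ,ε,N]))
        ∂(Measure.pi fun _ : Fin N => μ) ≤
      ENNReal.ofReal (Real.exp (-(ldtT[μ,ε,N] * N * (andersonLyapunov μ E - ε / 2)))) := by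
  set P : Measure (Fin N → ℝ) := Measure.pi fun _ : Fin N => μ with hP
  set L : ℝ := andersonLyapunov μ E with hLdef
  set lg : ℝ := Real.log (Γ[μ]) with hlg
  set B : ℝ := ldtB[μ,ε] with hBdef
  set s : ℝ := 1 / (2 * B ^ 2) with hsdef
  set t : ℝ := ldtT[μ,ε,N] with htdef
  have hN : (0 : ℝ) < N := by exact_mod_cast hN1
  have hB1 : 1 ≤ B := one_le_ldtB μ hε0 hε1
  have hts : t = s * (4 / (N * ε)) := by
    rw [htdef, hsdef, hBdef]; ring
  have hL0 : 0 ≤ L := andersonLyapunov_nonneg μ E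
  have hL1 : L ≤ lg := andersonLyapunov_le_log μ hc hE
  have hlg1 : 1 ≤ lg := one_le_log_gam μ
  set f : (Fin N → ℝ) → ℝ := fun y =>
    Real.log ‖Matrix.toEuclideanLin (andersonTransferProd E (padSeq y) N) u‖ with hfdef
  have hfm : Measurable f := measurable_log_norm_andersonTransferProd_apply E N u
  have hfi : Integrable f P := integrable_log_norm_apply hc hE N le_rfl hu
  -- the normalised log-moment
  set g : (Fin N → ℝ) → ℝ := fun y => (f y - N * (L - ε / 2)) * (4 / (N * ε)) with hgdef
  have hgm : Measurable g := (hfm.sub measurable_const).mul_const _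
  have hcoef : 0 < 4 / (N * ε) := by positivity
  have hbound : ∀ᵐ y ∂P, |g y| ≤ B := by
    filter_upwards [ae_pi_abs_le_kappa_sub_two hc N] with y hy
    have h1 : |f y| ≤ N * lg := abs_log_norm_apply_le_of_box hE hy hu N le_rfl
    rw [hgdef]
    simp only
    rw [abs_mul, abs_of_pos hcoef]
    have h2 : |f y - N * (L - ε / 2)| ≤ N * (2 * lg + 1 / 2) := by
      rw [abs_le] at h1 ⊢
      constructor <;> nlinarith [h1.1, h1.2, hL0, hL1, hε1, hN]
    calc |f y - N * (L - ε / 2)| * (4 / (N * ε)) ≤ N * (2 * lg + 1 / 2) * (4 / (N * ε)) := by gcongr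
      _ = (8 * lg + 2) / ε := by field_simp; ring
      _ ≤ B := by
          rw [hBdef]
          gcongr
          norm_num
  have hmean : 1 ≤ ∫ y, g y ∂P := by
    have h1 : ∫ y, g y ∂P = (∫ y, f y ∂P - N * (L - ε / 2)) * (4 / (N * ε)) := by
      rw [hgdef]
      simp only
      rw [integral_mul_const, integral_sub hfi (integrable_const _), integral_const, probReal_univ, one_smul]
    rw [h1]
    have h2 : (N : ℝ) * (L - ε / 4) ≤ ∫ y, f y ∂P := hlow u hu
    have h3 : N * ε / 4 ≤ ∫ y, f y ∂P - N * (L - ε / 2) := by linarith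
    calc (1 : ℝ) = N * ε / 4 * (4 / (N * ε)) := by field_simp
      _ ≤ _ := by gcongr
  have hexp := integral_exp_neg_mul_le P hgm hB1 hbound hmean
  rw [← hsdef] at hexp
  -- identify the integrand with ‖M_N u‖^{-t} e^{tN(L-ε/2)}
  have hpos : ∀ y : Fin N → ℝ, 0 < ‖Matrix.toEuclideanLin (andersonTransferProd E (padSeq y) N) u‖ := fun y =>
    norm_apply_pos E y (ne_zero_of_norm_eq_one hu) N
  have hid : ∀ y : Fin N → ℝ, Real.exp (-(s * g y)) =
      ‖Matrix.toEuclideanLin (andersonTransferProd E (padSeq y) N) u‖ ^ (-t) *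
        Real.exp (t * N * (L - ε / 2)) := by
    intro y
    rw [Real.rpow_def_of_pos (hpos y), ← Real.exp_add]
    congr 1
    rw [hgdef, hts]
    simp only [hfdef]
    ring
  have hK : 0 < Real.exp (t * N * (L - ε / 2)) := Real.exp_pos _
  -- ∫ ‖M_N u‖^{-t} ≤ e^{-tN(L-ε/2)}
  set h : (Fin N → ℝ) → ℝ := fun y => ‖Matrix.toEuclideanLin (andersonTransferProd E (padSeq y) N) u‖ ^ (-t)
    with hhdef
  have hhm : Measurable h := measurable_rpow_norm_apply E (-t) N (ne_zero_of_norm_eq_one hu)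
  have ht0 : 0 < t := ldtT_pos μ hε0 hN1
  have hhi : Integrable h P := by
    refine Integrable.of_bound hhm.aestronglyMeasurable ((Γ[μ] ^ N) ^ t) ?_
    filter_upwards [ae_pi_abs_le_kappa_sub_two hc N] with y hy
    have hG : 0 < Γ[μ] ^ N := pow_pos (gam_pos μ) N
    obtain ⟨-, h2⟩ := norm_apply_bounds_of_box hE hy u N le_rfl
    rw [hu] at h2
    have hinv : (Γ[μ] ^ N)⁻¹ ≤ ‖Matrix.toEuclideanLin (andersonTransferProd E (padSeq y) N) u‖ := by
      rw [inv_le_iff_one_le_mul₀ hG, mul_comm]; exact h2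
    rw [Real.norm_eq_abs, abs_of_nonneg (Real.rpow_nonneg (norm_nonneg _) _)]
    calc ‖Matrix.toEuclideanLin (andersonTransferProd E (padSeq y) N) u‖ ^ (-t)
        ≤ ((Γ[μ] ^ N)⁻¹) ^ (-t) :=
          Real.rpow_le_rpow_of_nonpos (inv_pos.mpr hG) hinv (by linarith)
      _ = (Γ[μ] ^ N) ^ t := by rw [Real.inv_rpow hG.le, Real.rpow_neg hG.le, inv_inv]
  have hint : ∫ y, h y ∂P ≤ Real.exp (-(t * N * (L - ε / 2))) := by
    have h1 : ∫ y, Real.exp (-(s * g y)) ∂P = (∫ y, h y ∂P) * Real.exp (t * N * (L - ε / 2)) := by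
      rw [← integral_mul_const]
      exact integral_congr_ae (Eventually.of_forall fun y => hid y)
    rw [h1] at hexp
    have h2 : (∫ y, h y ∂P) * Real.exp (t * N * (L - ε / 2)) ≤ 1 := by
      refine hexp.trans ?_
      have : 0 < s := by rw [hsdef]; positivity
      linarith
    rw [Real.exp_neg, ← one_div]
    exact (le_div_iff₀ hK).mpr h2
  have hnn : 0 ≤ᵐ[P] h := Eventually.of_forall fun y => Real.rpow_nonneg (norm_nonneg _) _
  rw [← ofReal_integral_eq_lintegral_ofReal hhi hnn]
  exact ENNReal.ofReal_le_ofReal hint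

/-- **Upper one-scale moment bound.** If `∫ log ‖M_N u‖ dμ^{⊗N} ≤ N (L + ε/4)` for all unit `u`, then with
`t = ldtT[μ,ε,N]`, `∫ ‖M_N u‖^{t} dμ^{⊗N} ≤ e^{tN(L + ε/2)}` for all unit `u`.
[cite: BucajEtAl2019, §3 (Prop. 3.4 ⇒ Prop. 3.6, upper deviations; moment form)] -/
theorem lintegral_rpow_pos_le {μ : Measure ℝ} [IsProbabilityMeasure μ] (hc : IsCompact μ.support)
    {E : ℝ} (hE : E ∈ Icc (-andersonKappa μ) (andersonKappa μ)) {ε : ℝ} (hε0 : 0 < ε) (hε1 : ε ≤ 1)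
    {N : ℕ} (hN1 : 1 ≤ N)
    (hup : ∀ u : EuclideanSpace ℝ (Fin 2), ‖u‖ = 1 →
      ∫ y, Real.log ‖Matrix.toEuclideanLin (andersonTransferProd E (padSeq y) N) u‖ ∂(Measure.pi fun _ : Fin N => μ) ≤
        (N : ℝ) * (andersonLyapunov μ E + ε / 4))
    {u : EuclideanSpace ℝ (Fin 2)} (hu : ‖u‖ = 1) :
    ∫⁻ y, ENNReal.ofReal (‖Matrix.toEuclideanLin (andersonTransferProd E (padSeq y) N) u‖ ^ (ldtT[μ,ε,N]))
        ∂(Measure.pi fun _ : Fin N => μ) ≤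
      ENNReal.ofReal (Real.exp (ldtT[μ,ε,N] * N * (andersonLyapunov μ E + ε / 2))) := by
  set P : Measure (Fin N → ℝ) := Measure.pi fun _ : Fin N => μ with hP
  set L : ℝ := andersonLyapunov μ E with hLdef
  set lg : ℝ := Real.log (Γ[μ]) with hlg
  set B : ℝ := ldtB[μ,ε] with hBdef
  set s : ℝ := 1 / (2 * B ^ 2) with hsdef
  set t : ℝ := ldtT[μ,ε,N] with htdef
  have hN : (0 : ℝ) < N := by exact_mod_cast hN1
  have hB1 : 1 ≤ B := one_le_ldtB μ hε0 hε1
  have hts : t = s * (4 / (N * ε)) := by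
    rw [htdef, hsdef, hBdef]; ring
  have hL0 : 0 ≤ L := andersonLyapunov_nonneg μ E
  have hL1 : L ≤ lg := andersonLyapunov_le_log μ hc hE
  have hlg1 : 1 ≤ lg := one_le_log_gam μ
  set f : (Fin N → ℝ) → ℝ := fun y =>
    Real.log ‖Matrix.toEuclideanLin (andersonTransferProd E (padSeq y) N) u‖ with hfdef
  have hfm : Measurable f := measurable_log_norm_andersonTransferProd_apply E N u
  have hfi : Integrable f P := integrable_log_norm_apply hc hE N le_rfl hu
  set g : (Fin N → ℝ) → ℝ := fun y => (N * (L + ε / 2) - f y) * (4 / (N * ε)) with hgdef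
  have hgm : Measurable g := (measurable_const.sub hfm).mul_const _
  have hcoef : 0 < 4 / (N * ε) := by positivity
  have hbound : ∀ᵐ y ∂P, |g y| ≤ B := by
    filter_upwards [ae_pi_abs_le_kappa_sub_two hc N] with y hy
    have h1 : |f y| ≤ N * lg := abs_log_norm_apply_le_of_box hE hy hu N le_rfl
    rw [hgdef]
    simp only
    rw [abs_mul, abs_of_pos hcoef]
    have h2 : |N * (L + ε / 2) - f y| ≤ N * (2 * lg + 1 / 2) := by
      rw [abs_le] at h1 ⊢
      constructor <;> nlinarith [h1.1, h1.2, hL0, hL1, hε1, hN]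
    calc |N * (L + ε / 2) - f y| * (4 / (N * ε)) ≤ N * (2 * lg + 1 / 2) * (4 / (N * ε)) := by gcongr
      _ = (8 * lg + 2) / ε := by field_simp; ring
      _ ≤ B := by
          rw [hBdef]
          gcongr
          norm_num
  have hmean : 1 ≤ ∫ y, g y ∂P := by
    have h1 : ∫ y, g y ∂P = (N * (L + ε / 2) - ∫ y, f y ∂P) * (4 / (N * ε)) := by
      rw [hgdef]
      simp only
      rw [integral_mul_const, integral_sub (integrable_const _) hfi, integral_const, probReal_univ, one_smul]
    rw [h1]
    have h2 : ∫ y, f y ∂P ≤ (N : ℝ) * (L + ε / 4) := hup u hu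
    have h3 : N * ε / 4 ≤ N * (L + ε / 2) - ∫ y, f y ∂P := by linarith
    calc (1 : ℝ) = N * ε / 4 * (4 / (N * ε)) := by field_simp
      _ ≤ _ := by gcongr
  have hexp := integral_exp_neg_mul_le P hgm hB1 hbound hmean
  rw [← hsdef] at hexp
  have hpos : ∀ y : Fin N → ℝ, 0 < ‖Matrix.toEuclideanLin (andersonTransferProd E (padSeq y) N) u‖ := fun y =>
    norm_apply_pos E y (ne_zero_of_norm_eq_one hu) N
  have hid : ∀ y : Fin N → ℝ, Real.exp (-(s * g y)) =
      ‖Matrix.toEuclideanLin (andersonTransferProd E (padSeq y) N) u‖ ^ t *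
        Real.exp (-(t * N * (L + ε / 2))) := by
    intro y
    rw [Real.rpow_def_of_pos (hpos y), ← Real.exp_add]
    congr 1
    rw [hgdef, hts]
    simp only [hfdef]
    ring
  have hK : 0 < Real.exp (-(t * N * (L + ε / 2))) := Real.exp_pos _
  set h : (Fin N → ℝ) → ℝ := fun y => ‖Matrix.toEuclideanLin (andersonTransferProd E (padSeq y) N) u‖ ^ t
    with hhdef
  have hhm : Measurable h := measurable_rpow_norm_apply E t N (ne_zero_of_norm_eq_one hu)
  have ht0 : 0 < t := ldtT_pos μ hε0 hN1
  have hhi : Integrable h P := by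
    refine Integrable.of_bound hhm.aestronglyMeasurable ((Γ[μ] ^ N) ^ t) ?_
    filter_upwards [ae_pi_abs_le_kappa_sub_two hc N] with y hy
    obtain ⟨h1, -⟩ := norm_apply_bounds_of_box hE hy u N le_rfl
    rw [hu, mul_one] at h1
    rw [Real.norm_eq_abs, abs_of_nonneg (Real.rpow_nonneg (norm_nonneg _) _)]
    exact Real.rpow_le_rpow (norm_nonneg _) h1 ht0.le
  have hint : ∫ y, h y ∂P ≤ Real.exp (t * N * (L + ε / 2)) := by
    have h1 : ∫ y, Real.exp (-(s * g y)) ∂P = (∫ y, h y ∂P) * Real.exp (-(t * N * (L + ε / 2))) := by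
      rw [← integral_mul_const]
      exact integral_congr_ae (Eventually.of_forall fun y => hid y)
    rw [h1] at hexp
    have h2 : (∫ y, h y ∂P) * Real.exp (-(t * N * (L + ε / 2))) ≤ 1 := by
      refine hexp.trans ?_
      have : 0 < s := by rw [hsdef]; positivity
      linarith
    rw [Real.exp_neg] at h2
    rwa [mul_inv_le_iff₀ (Real.exp_pos _), one_mul] at h2
  have hnn : 0 ≤ᵐ[P] h := Eventually.of_forall fun y => Real.rpow_nonneg (norm_nonneg _) _
  rw [← ofReal_integral_eq_lintegral_ofReal hhi hnn]
  exact ENNReal.ofReal_le_ofReal hint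

/-! ### The two tails by Markov's inequality -/

/-- **Lower deviations.** Under the lower one-scale log-moment bound at scale `N`, for every `n ≥ 1` and
every unit vector `w`,
`μ^{⊗n}{n⁻¹ log ‖M_n w‖ - L(E) ≤ -ε} ≤ e^{2tN log Γ} e^{-(tε/2) n}` (`t = ldtT[μ,ε,N]`).
[cite: BucajEtAl2019, Prop. 3.6 (the set `𝓑ₙ⁻`)] -/
theorem measure_lowerTail_le {μ : Measure ℝ} [IsProbabilityMeasure μ] (hc : IsCompact μ.support)
    {E : ℝ} (hE : E ∈ Icc (-andersonKappa μ) (andersonKappa μ)) {ε : ℝ} (hε0 : 0 < ε) (hε1 : ε ≤ 1)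
    {N : ℕ} (hN1 : 1 ≤ N)
    (hlow : ∀ u : EuclideanSpace ℝ (Fin 2), ‖u‖ = 1 →
      (N : ℝ) * (andersonLyapunov μ E - ε / 4) ≤
        ∫ y, Real.log ‖Matrix.toEuclideanLin (andersonTransferProd E (padSeq y) N) u‖ ∂(Measure.pi fun _ : Fin N => μ))
    {n : ℕ} (hn : 1 ≤ n) {w : EuclideanSpace ℝ (Fin 2)} (hw : ‖w‖ = 1) :
    (Measure.pi fun _ : Fin n => μ)
        {x | 1 / (n : ℝ) * Real.log ‖Matrix.toEuclideanLin (andersonTransferProd E (padSeq x) n) w‖ -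
          andersonLyapunov μ E ≤ -ε} ≤
      ENNReal.ofReal (Real.exp (2 * ldtT[μ,ε,N] * N * Real.log (Γ[μ])) *
        Real.exp (-(ldtT[μ,ε,N] * ε / 2 * n))) := by
  have hw0 := ne_zero_of_norm_eq_one hw
  set t : ℝ := ldtT[μ,ε,N] with htdef
  have ht0 : 0 < t := ldtT_pos μ hε0 hN1
  set L : ℝ := andersonLyapunov μ E with hL
  set lg : ℝ := Real.log (Γ[μ]) with hlg
  have hL0 : 0 ≤ L := andersonLyapunov_nonneg μ E
  have hL1 : L ≤ lg := andersonLyapunov_le_log μ hc hE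
  have hlg0 : 0 ≤ lg := (log_gam_pos μ).le
  have hΓ := gam_pos μ
  have hGN : 0 < Γ[μ] ^ N := pow_pos hΓ N
  set P : Measure (Fin n → ℝ) := Measure.pi fun _ : Fin n => μ with hP
  set a : (Fin n → ℝ) → ℝ := fun x => ‖Matrix.toEuclideanLin (andersonTransferProd E (padSeq x) n) w‖ with ha
  have hapos : ∀ x, 0 < a x := fun x => norm_apply_pos E x hw0 n
  -- the moment bound at scale n
  set b₂ : ℝ := Real.exp (-(t * N * (L - ε / 2))) with hb₂
  have hmom : ∫⁻ x, ENNReal.ofReal (a x ^ (-t)) ∂P ≤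
      ENNReal.ofReal ((Γ[μ] ^ N) ^ t) * ENNReal.ofReal b₂ ^ (n / N) := by
    refine lintegral_rpow_norm_apply_le μ E (-t) hN1 (fun u hu => ?_) (fun j hj u hu => ?_) n w hw
    · exact lintegral_rpow_neg_le hc hE hε0 hε1 hN1 hlow hu
    · refine (lintegral_rpow_norm_apply_le_pow hc hE (-t) j hu).trans (ENNReal.ofReal_le_ofReal ?_)
      rw [abs_neg, abs_of_pos ht0]
      exact Real.rpow_le_rpow (by positivity) (pow_le_pow_right₀ (one_le_gam μ) hj.le) ht0.le
  -- Markov's inequality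
  set θ : ℝ := Real.exp (-(t * n * (L - ε))) with hθ
  have hθ0 : 0 < θ := Real.exp_pos _
  have hn0 : (0 : ℝ) < n := by exact_mod_cast hn
  have hsub : {x | 1 / (n : ℝ) * Real.log (a x) - L ≤ -ε} ⊆
      {x | ENNReal.ofReal θ ≤ ENNReal.ofReal (a x ^ (-t))} := by
    intro x hx
    simp only [Set.mem_setOf_eq] at hx ⊢
    apply ENNReal.ofReal_le_ofReal
    have h1 : Real.log (a x) ≤ n * (L - ε) := by
      have : 1 / (n : ℝ) * Real.log (a x) ≤ L - ε := by linarith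
      calc Real.log (a x) = n * (1 / (n : ℝ) * Real.log (a x)) := by field_simp
        _ ≤ n * (L - ε) := by gcongr
    have h2 : a x ≤ Real.exp (n * (L - ε)) := (Real.log_le_iff_le_exp (hapos x)).mp h1
    calc θ = Real.exp (n * (L - ε)) ^ (-t) := by rw [hθ, ← Real.exp_mul]; congr 1; ring
      _ ≤ a x ^ (-t) := Real.rpow_le_rpow_of_nonpos (hapos x) h2 (by linarith)
  have hmeas : AEMeasurable (fun x => ENNReal.ofReal (a x ^ (-t))) P :=
    (measurable_rpow_norm_apply E (-t) n hw0).ennreal_ofReal.aemeasurable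
  have hmarkov := mul_meas_ge_le_lintegral₀ hmeas (ENNReal.ofReal θ)
  have hθ' : ENNReal.ofReal θ ≠ 0 := (ENNReal.ofReal_pos.mpr hθ0).ne'
  -- bookkeeping of the exponents
  have hq1 : ((n / N : ℕ) : ℝ) * N ≤ n := by exact_mod_cast Nat.div_mul_le_self n N
  have hq2 : (n : ℝ) < ((n / N : ℕ) : ℝ) * N + N := by exact_mod_cast Nat.lt_div_mul_add (by omega : 0 < N)
  have hreal : (Γ[μ] ^ N) ^ t * b₂ ^ (n / N) / θ ≤
      Real.exp (2 * t * N * lg) * Real.exp (-(t * ε / 2 * n)) := by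
    rw [Real.rpow_def_of_pos hGN, Real.log_pow, hb₂, ← Real.exp_nat_mul, hθ, ← Real.exp_add, ← Real.exp_sub,
      ← Real.exp_add, Real.exp_le_exp]
    set q : ℝ := ((n / N : ℕ) : ℝ) with hq
    have hd0 : 0 ≤ (n : ℝ) - q * N := by linarith
    have hdN : (n : ℝ) - q * N ≤ N := by linarith
    have key : (L - ε / 2) * ((n : ℝ) - q * N) - N * lg ≤ 0 := by
      nlinarith [mul_nonneg hε0.le hd0, mul_le_mul_of_nonneg_right hL1 hd0, mul_le_mul_of_nonneg_left hdN hlg0]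
    have hid : (N : ℝ) * lg * t + q * -(t * N * (L - ε / 2)) - -(t * n * (L - ε)) -
        (2 * t * N * lg + -(t * ε / 2 * n)) = t * ((L - ε / 2) * ((n : ℝ) - q * N) - N * lg) := by ring
    nlinarith [mul_nonpos_of_nonneg_of_nonpos ht0.le key]
  calc P {x | 1 / (n : ℝ) * Real.log (a x) - L ≤ -ε}
      ≤ P {x | ENNReal.ofReal θ ≤ ENNReal.ofReal (a x ^ (-t))} := measure_mono hsub
    _ ≤ (ENNReal.ofReal ((Γ[μ] ^ N) ^ t) * ENNReal.ofReal b₂ ^ (n / N)) / ENNReal.ofReal θ := by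
        rw [ENNReal.le_div_iff_mul_le (Or.inl hθ') (Or.inl ENNReal.ofReal_ne_top), mul_comm]
        exact hmarkov.trans hmom
    _ = ENNReal.ofReal ((Γ[μ] ^ N) ^ t * b₂ ^ (n / N) / θ) := by
        rw [← ENNReal.ofReal_pow (Real.exp_pos _).le, ← ENNReal.ofReal_mul (by positivity),
          ENNReal.ofReal_div_of_pos hθ0]
    _ ≤ _ := ENNReal.ofReal_le_ofReal hreal

/-- **Upper deviations.** Under the upper one-scale log-moment bound at scale `N`, for every `n ≥ 1` and
every unit vector `w`,
`μ^{⊗n}{n⁻¹ log ‖M_n w‖ - L(E) ≥ ε} ≤ e^{tN log Γ} e^{-(tε/2) n}` (`t = ldtT[μ,ε,N]`).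
[cite: BucajEtAl2019, Prop. 3.6 (the set `𝓑ₙ⁺`)] -/
theorem measure_upperTail_le {μ : Measure ℝ} [IsProbabilityMeasure μ] (hc : IsCompact μ.support)
    {E : ℝ} (hE : E ∈ Icc (-andersonKappa μ) (andersonKappa μ)) {ε : ℝ} (hε0 : 0 < ε) (hε1 : ε ≤ 1)
    {N : ℕ} (hN1 : 1 ≤ N)
    (hup : ∀ u : EuclideanSpace ℝ (Fin 2), ‖u‖ = 1 →
      ∫ y, Real.log ‖Matrix.toEuclideanLin (andersonTransferProd E (padSeq y) N) u‖ ∂(Measure.pi fun _ : Fin N => μ) ≤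
        (N : ℝ) * (andersonLyapunov μ E + ε / 4))
    {n : ℕ} (hn : 1 ≤ n) {w : EuclideanSpace ℝ (Fin 2)} (hw : ‖w‖ = 1) :
    (Measure.pi fun _ : Fin n => μ)
        {x | ε ≤ 1 / (n : ℝ) * Real.log ‖Matrix.toEuclideanLin (andersonTransferProd E (padSeq x) n) w‖ -
          andersonLyapunov μ E} ≤
      ENNReal.ofReal (Real.exp (ldtT[μ,ε,N] * N * Real.log (Γ[μ])) *
        Real.exp (-(ldtT[μ,ε,N] * ε / 2 * n))) := by
  have hw0 := ne_zero_of_norm_eq_one hw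
  set t : ℝ := ldtT[μ,ε,N] with htdef
  have ht0 : 0 < t := ldtT_pos μ hε0 hN1
  set L : ℝ := andersonLyapunov μ E with hL
  set lg : ℝ := Real.log (Γ[μ]) with hlg
  have hL0 : 0 ≤ L := andersonLyapunov_nonneg μ E
  have hΓ := gam_pos μ
  have hGN : 0 < Γ[μ] ^ N := pow_pos hΓ N
  set P : Measure (Fin n → ℝ) := Measure.pi fun _ : Fin n => μ with hP
  set a : (Fin n → ℝ) → ℝ := fun x => ‖Matrix.toEuclideanLin (andersonTransferProd E (padSeq x) n) w‖ with ha
  have hapos : ∀ x, 0 < a x := fun x => norm_apply_pos E x hw0 n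
  set b₂ : ℝ := Real.exp (t * N * (L + ε / 2)) with hb₂
  have hmom : ∫⁻ x, ENNReal.ofReal (a x ^ t) ∂P ≤
      ENNReal.ofReal ((Γ[μ] ^ N) ^ t) * ENNReal.ofReal b₂ ^ (n / N) := by
    refine lintegral_rpow_norm_apply_le μ E t hN1 (fun u hu => ?_) (fun j hj u hu => ?_) n w hw
    · exact lintegral_rpow_pos_le hc hE hε0 hε1 hN1 hup hu
    · refine (lintegral_rpow_norm_apply_le_pow hc hE t j hu).trans (ENNReal.ofReal_le_ofReal ?_)
      rw [abs_of_pos ht0]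
      exact Real.rpow_le_rpow (by positivity) (pow_le_pow_right₀ (one_le_gam μ) hj.le) ht0.le
  set θ : ℝ := Real.exp (t * n * (L + ε)) with hθ
  have hθ0 : 0 < θ := Real.exp_pos _
  have hn0 : (0 : ℝ) < n := by exact_mod_cast hn
  have hsub : {x | ε ≤ 1 / (n : ℝ) * Real.log (a x) - L} ⊆
      {x | ENNReal.ofReal θ ≤ ENNReal.ofReal (a x ^ t)} := by
    intro x hx
    simp only [Set.mem_setOf_eq] at hx ⊢
    apply ENNReal.ofReal_le_ofReal
    have h1 : n * (L + ε) ≤ Real.log (a x) := by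
      have : L + ε ≤ 1 / (n : ℝ) * Real.log (a x) := by linarith
      calc (n : ℝ) * (L + ε) ≤ n * (1 / (n : ℝ) * Real.log (a x)) := by gcongr
        _ = Real.log (a x) := by field_simp
    have h2 : Real.exp (n * (L + ε)) ≤ a x := (Real.le_log_iff_exp_le (hapos x)).mp h1
    calc θ = Real.exp (n * (L + ε)) ^ t := by rw [hθ, ← Real.exp_mul]; congr 1; ring
      _ ≤ a x ^ t := Real.rpow_le_rpow (Real.exp_pos _).le h2 ht0.le
  have hmeas : AEMeasurable (fun x => ENNReal.ofReal (a x ^ t)) P :=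
    (measurable_rpow_norm_apply E t n hw0).ennreal_ofReal.aemeasurable
  have hmarkov := mul_meas_ge_le_lintegral₀ hmeas (ENNReal.ofReal θ)
  have hθ' : ENNReal.ofReal θ ≠ 0 := (ENNReal.ofReal_pos.mpr hθ0).ne'
  have hq1 : ((n / N : ℕ) : ℝ) * N ≤ n := by exact_mod_cast Nat.div_mul_le_self n N
  have hreal : (Γ[μ] ^ N) ^ t * b₂ ^ (n / N) / θ ≤
      Real.exp (t * N * lg) * Real.exp (-(t * ε / 2 * n)) := by
    rw [Real.rpow_def_of_pos hGN, Real.log_pow, hb₂, ← Real.exp_nat_mul, hθ, ← Real.exp_add, ← Real.exp_sub,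
      ← Real.exp_add, Real.exp_le_exp]
    set q : ℝ := ((n / N : ℕ) : ℝ) with hq
    have hd0 : 0 ≤ (n : ℝ) - q * N := by linarith
    have key : (L + ε / 2) * (q * N - (n : ℝ)) ≤ 0 := by nlinarith
    have hid : (N : ℝ) * lg * t + q * (t * N * (L + ε / 2)) - t * n * (L + ε) -
        (t * N * lg + -(t * ε / 2 * n)) = t * ((L + ε / 2) * (q * N - (n : ℝ))) := by ring
    nlinarith [mul_nonpos_of_nonneg_of_nonpos ht0.le key]
  calc P {x | ε ≤ 1 / (n : ℝ) * Real.log (a x) - L}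
      ≤ P {x | ENNReal.ofReal θ ≤ ENNReal.ofReal (a x ^ t)} := measure_mono hsub
    _ ≤ (ENNReal.ofReal ((Γ[μ] ^ N) ^ t) * ENNReal.ofReal b₂ ^ (n / N)) / ENNReal.ofReal θ := by
        rw [ENNReal.le_div_iff_mul_le (Or.inl hθ') (Or.inl ENNReal.ofReal_ne_top), mul_comm]
        exact hmarkov.trans hmom
    _ = ENNReal.ofReal ((Γ[μ] ^ N) ^ t * b₂ ^ (n / N) / θ) := by
        rw [← ENNReal.ofReal_pow (Real.exp_pos _).le, ← ENNReal.ofReal_mul (by positivity),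
          ENNReal.ofReal_div_of_pos hθ0]
    _ ≤ _ := ENNReal.ofReal_le_ofReal hreal

/-! ### The bootstrapping theorem -/

/-- **From one-scale uniform log-moment bounds to the vectorwise uniform LDT** (the block argument of
Bucaj et al. Prop. 3.6 in moment form). If for every `ε > 0` there is a scale `N ≥ 1` with
`|∫ log ‖M_N^E u‖ dμ^{⊗N} - N L(E)| ≤ N ε` for all `E ∈ Σ̂ = [-κ, κ]` and all unit vectors `u`, then for
every `ε > 0` there are `C, η > 0` with
`μ^{⊗n}{|n⁻¹ log ‖M_n^E v‖ - L(E)| ≥ ε} ≤ C e^{-η n}` for all `n ≥ 1`, all unit `v` and all `E ∈ Σ̂`.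
[cite: BucajEtAl2019, Prop. 3.6 (proof)] -/
theorem vectorLDT_of_uniformScale (μ : Measure ℝ) [IsProbabilityMeasure μ] (hc : IsCompact μ.support)
    (hU : ∀ ε : ℝ, 0 < ε → ∃ N : ℕ, 1 ≤ N ∧
      ∀ E ∈ Icc (-andersonKappa μ) (andersonKappa μ), ∀ u : EuclideanSpace ℝ (Fin 2), ‖u‖ = 1 →
        |(∫ y, Real.log ‖Matrix.toEuclideanLin (andersonTransferProd E (padSeq y) N) u‖
            ∂(Measure.pi fun _ : Fin N => μ)) - N * andersonLyapunov μ E| ≤ N * ε) :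
    ∀ ε : ℝ, 0 < ε → ∃ C η : ℝ, 0 < C ∧ 0 < η ∧ ∀ n : ℕ, 1 ≤ n →
      ∀ v : EuclideanSpace ℝ (Fin 2), ‖v‖ = 1 →
        ∀ E ∈ Icc (-andersonKappa μ) (andersonKappa μ),
          (Measure.pi fun _ : Fin n => μ) (andersonVectorLDSet μ E ε n v) ≤
            ENNReal.ofReal (C * Real.exp (-(η * n))) := by
  intro ε hε
  set ε₁ : ℝ := min ε 1 with hε₁
  have hε₁0 : 0 < ε₁ := lt_min hε one_pos
  have hε₁1 : ε₁ ≤ 1 := min_le_right _ _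
  have hε₁ε : ε₁ ≤ ε := min_le_left _ _
  obtain ⟨N, hN1, hN⟩ := hU (ε₁ / 4) (by positivity)
  set t : ℝ := ldtT[μ,ε₁,N] with ht
  have ht0 : 0 < t := ldtT_pos μ hε₁0 hN1
  set lg : ℝ := Real.log (Γ[μ]) with hlg
  refine ⟨Real.exp (2 * t * N * lg) + Real.exp (t * N * lg), t * ε₁ / 2, by positivity, by positivity, ?_⟩
  intro n hn v hv E hE
  have hlow : ∀ u : EuclideanSpace ℝ (Fin 2), ‖u‖ = 1 →
      (N : ℝ) * (andersonLyapunov μ E - ε₁ / 4) ≤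
        ∫ y, Real.log ‖Matrix.toEuclideanLin (andersonTransferProd E (padSeq y) N) u‖ ∂(Measure.pi fun _ : Fin N => μ) :=
    fun u hu => by have := (abs_le.mp (hN E hE u hu)).1; linarith
  have hup : ∀ u : EuclideanSpace ℝ (Fin 2), ‖u‖ = 1 →
      ∫ y, Real.log ‖Matrix.toEuclideanLin (andersonTransferProd E (padSeq y) N) u‖ ∂(Measure.pi fun _ : Fin N => μ) ≤
        (N : ℝ) * (andersonLyapunov μ E + ε₁ / 4) :=
    fun u hu => by have := (abs_le.mp (hN E hE u hu)).2; linarith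
  have hsplit : andersonVectorLDSet μ E ε n v ⊆
      {x | 1 / (n : ℝ) * Real.log ‖Matrix.toEuclideanLin (andersonTransferProd E (padSeq x) n) v‖ -
          andersonLyapunov μ E ≤ -ε₁} ∪
      {x | ε₁ ≤ 1 / (n : ℝ) * Real.log ‖Matrix.toEuclideanLin (andersonTransferProd E (padSeq x) n) v‖ -
          andersonLyapunov μ E} := by
    intro x hx
    simp only [andersonVectorLDSet, Set.mem_setOf_eq] at hx
    rcases le_abs'.mp hx with h | h
    · left
      simp only [Set.mem_setOf_eq]
      linarith
    · right
      simp only [Set.mem_setOf_eq]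
      linarith
  calc (Measure.pi fun _ : Fin n => μ) (andersonVectorLDSet μ E ε n v)
      ≤ (Measure.pi fun _ : Fin n => μ) ({x | 1 / (n : ℝ) *
            Real.log ‖Matrix.toEuclideanLin (andersonTransferProd E (padSeq x) n) v‖ - andersonLyapunov μ E ≤ -ε₁} ∪
          {x | ε₁ ≤ 1 / (n : ℝ) * Real.log ‖Matrix.toEuclideanLin (andersonTransferProd E (padSeq x) n) v‖ -
            andersonLyapunov μ E}) := measure_mono hsplit
    _ ≤ (Measure.pi fun _ : Fin n => μ) {x | 1 / (n : ℝ) *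
            Real.log ‖Matrix.toEuclideanLin (andersonTransferProd E (padSeq x) n) v‖ - andersonLyapunov μ E ≤ -ε₁} +
        (Measure.pi fun _ : Fin n => μ) {x | ε₁ ≤ 1 / (n : ℝ) *
            Real.log ‖Matrix.toEuclideanLin (andersonTransferProd E (padSeq x) n) v‖ - andersonLyapunov μ E} :=
        measure_union_le _ _
    _ ≤ ENNReal.ofReal (Real.exp (2 * t * N * lg) * Real.exp (-(t * ε₁ / 2 * n))) +
        ENNReal.ofReal (Real.exp (t * N * lg) * Real.exp (-(t * ε₁ / 2 * n))) :=
        add_le_add (measure_lowerTail_le hc hE hε₁0 hε₁1 hN1 hlow hn hv)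
          (measure_upperTail_le hc hE hε₁0 hε₁1 hN1 hup hn hv)
    _ = ENNReal.ofReal ((Real.exp (2 * t * N * lg) + Real.exp (t * N * lg)) * Real.exp (-(t * ε₁ / 2 * n))) := by
        rw [← ENNReal.ofReal_add (by positivity) (by positivity)]
        congr 1
        ring

end Literature.Probability.RandomMatrixProducts

end
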